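import Summits.QuantumFields.BalabanUV.T4Continuum.Support.NE9BridgeSizeInduction
import Summits.QuantumFields.BalabanUV.T4Continuum.Support.NE9MarginalProjection

/-!
# NE9MarginalProjectionEnd — the NE9 END of the lineage at `T := 𝒯 ∘ P` (history channel fed MARGINAL-FREE old terms) and the
necessity toy (skeleton `t4/b2b-balaban-t4-ne9-p1/SKELETON-NE9-P1.md` v1.3, leaf S5 / open statement O-NE9-2; cell `pub-balaban`,
T4-DAG §2 node U3 / §6 NE9; lineage t4-ne9-p1 = prover P1, generation 22)

HONEST FRAMING (T4-DAG PAGE 1).  Rung (B)+1 on a FIXED finite torus with `FlowStep.BetaPertH` and (B) explicit — NOT infinite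
volume, NOT a mass gap, NOT the Clay problem.  NE9 is a cell NEW ESTIMATE, NOT PRINTED, NOT discharged here: bookkeeping over the
ABSTRACT carriers; every analytic input a DISPLAYED binder; [I] = [Balaban1987RG1], [II] = [Balaban1988RG2Cluster] quoted for
TYPES/STRUCTURE only (ABSOLUTE RULE).  BetaPertH, (B), (B^μ) do not occur.  0/9 unchanged.

WHY.  See the sibling `NE9MarginalProjection` (this generation): the per-creation-step gain `L^jη` of [II] p. 8 l. 9–10 — the
source of the fading memory — is, by the mechanism of [I] p. 258 ((0.28)–(0.29): *"−β_j(g_{j−1})A^η(U_k) + 𝐄^{(j)}(U_k) =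
Σ_{X∈𝐃_j} 𝐕^{(j)}(X, U_k)"*, *"|𝐕^{(j)}(X, U_k)| ≦ O(1)(L^jη)^{4+α}exp(−κd_j(X))"*), a property of MARGINAL-FREE inputs (term +
coupling-renormalization counterterm, packaged scale by scale in the old action (1.3) p. 260), while the cell's term family is
counterterm-free (node U2 reads β from it).  So the frame's history channel is `T := 𝒯 ∘ P` with `P` the read-out projection.

WHAT IS PROVED (kernel, `[folklore]` bookkeeping; nothing about [I]/[II] asserted).
§1 END `ne9_and_fadingMemory_of_couplingTwoPoint_vacSub_sizeInduction_compProj` = g21's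
   `NE9BridgeSizeInduction.ne9_and_fadingMemory_of_couplingTwoPoint_vacSub_sizeInduction` at `T := compProj 𝒯 P`: the channel
   binders S3/S5 are about `𝒯` ON THE MARGINAL-FREE CLASS plus the four projection binders; rate `ω + 8·lipbar·B·((1 + c)·τ̄)`;
   corollary `…_margProj` for `P := margProj r A` (c = cr·a; `ProjInto` displayed: `r` normalised by `r(A) = 1`).
§2 necessity toy: a step-sum additive channel that satisfies the per-step size binder with the profile `ω^{k−j}` on the
   marginal-free class and with NO geometric profile of ratio < 1 on the full class (`not_fading_on_full_class` — the kernel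
   shadow of the witness «`c·A_□` on the scale-j cubes feeds the step-k curly bracket the full fluctuation quadratic form»); the
   read-out projection cures it (`toy_compProj_fading`, profile `2ω^{k−j}`).

References (TYPES/STRUCTURE only): [Balaban1987RG1] CMP 109 (1987) (0.27)–(0.30) p. 258, (1.3) p. 260, (1.18) p. 263,
(1.20)–(1.22) p. 264, (2.12)–(2.14) p. 268; [Balaban1988RG2Cluster] CMP 116 (1988) p. 8 l. 9–10, (1.36) p. 9, Lemma 3 (2.38) p. 20.
-/

noncomputable section

namespace Summit.QuantumFields.BalabanUV.T4Continuum.NE9MarginalProjectionEnd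

open scoped BigOperators
open Literature.Probability.LatticeModels
open Literature.MathematicalPhysics.QuantumFieldTheory.Balaban1983to89
open Literature.MathematicalPhysics.QuantumFieldTheory.Balaban1983to89.T4OutputRate
open Literature.MathematicalPhysics.QuantumFieldTheory.Balaban1983to89.T4HistoryLipschitzRecursion
open Literature.MathematicalPhysics.QuantumFieldTheory.Balaban1983to89.T4HistoryLipschitzOuter
open Literature.MathematicalPhysics.QuantumFieldTheory.Balaban1983to89.T4HistoryLipschitzActivity
open Literature.MathematicalPhysics.QuantumFieldTheory.Balaban1983to89.T4HistoryLipschitzActivity (ClusterGeom)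
open Literature.MathematicalPhysics.QuantumFieldTheory.Balaban1983to89.T4HistoryLipschitzSegment
open Summit.QuantumFields.BalabanUV.T4Continuum.NE9BridgeSizeInduction
open Summit.QuantumFields.BalabanUV.T4Continuum.NE9MarginalProjection

variable {C : Carriers} {Bg ι : Type}

/-! ## §1 The END at `T := 𝒯 ∘ P` -/

/-- **NE9 ∧ FADING MEMORY ∧ TERM SIZE with the history channel fed MARGINAL-FREE old terms** — g21's END
`NE9BridgeSizeInduction.ne9_and_fadingMemory_of_couplingTwoPoint_vacSub_sizeInduction` at `T := compProj 𝒯 P`: the three channel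
binders S3/S5 are now about `𝒯` ON THE MARGINAL-FREE CLASS `MF` (where [I] p. 258 / [II] pp. 7–9 place the gain `L^jη`) plus the
four projection binders; every other binder is g21's with `T ↦ 𝒯 ∘ P`, `τ ↦ (1 + c)·τ`.  Rate `ω + 8·lipbar·B·((1 + c)·τ̄)`.
[cite: Balaban1987RG1, (0.28)-(0.29) p.258, (1.3) p.260, (1.18) p.263, (2.12)-(2.14) p.268; Balaban1988RG2Cluster, p.8 l.9-10, (1.36) p.9, Lemma 3 (2.38) p.20] -/
theorem ne9_and_fadingMemory_of_couplingTwoPoint_vacSub_sizeInduction_compProj (G : ClusterGeom C) {Pot : Type*}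
    [NormedAddCommGroup Pot] [NormedSpace ℂ Pot] {E : Functional C Bg} {W : Set (ℕ → ℝ)} {Adm MF : Set (Bg → C.Dom → ℝ)}
    {P : (Bg → C.Dom → ℝ) → (Bg → C.Dom → ℝ)} {𝒯 : ℕ → (ℕ → ℝ) → (Bg → C.Dom → ℝ) → ι → ℝ}
    {Ψ : ℕ → ℝ → (ι → ℝ) → Bg → C.Dom → ℝ} {act : ℕ → ℝ → Bg → Pot → G.P → ℂ} {𝒜 : ℕ → Set Pot}
    {n : ℕ → ℝ → Bg → G.P → ℝ} {lip clip : ℕ → ℝ} {a d : G.P → ℝ} {δ : C.Dom → ℝ}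
    {κ B lipbar clipbar qTbar τbar ω c : ℝ} {wt : ℕ → ι → ℝ} {τ : ℕ → ℕ → ℝ} {qT p₀ N : ℕ → ℝ}
    (ρ : ℕ → (ι → ℝ) → Pot) (U₀ : Bg) (explZ : ℕ → Bg → C.Dom → ℝ) (h0 : ScaleZeroFree E W)
    (hAdm : AdmissibleTerms E W Adm) (hres : AdmRestrict Adm)
    -- the projection binders and the channel binders ON THE MARGINAL-FREE CLASS
    (hPadd : ProjAdditive Adm P) (hPcomm : ProjScaleComm Adm P) (hPinto : ProjInto Adm MF P) (hPsize : ProjSize Adm P κ c)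
    (hc : 0 ≤ c) (hadd : ChannelAdditive MF 𝒯) (hsum : ChannelStepSum MF 𝒯) (hstep : ChannelSizeAtStepNN MF 𝒯 κ wt τ)
    -- g21's remaining binders at `T := 𝒯 ∘ P`
    (hfac : Factorises E W (compProj 𝒯 P) Ψ) (hclip0 : ∀ k, 0 ≤ clip k)
    (hCup : ∀ g ∈ W, ∀ g' ∈ W, ∀ (k : ℕ) (U : Bg) (X : C.Dom), C.scale X = k + 1 → ∀ Q ∈ 𝒜 k, ∀ γ ∈ G.vol X,
      ‖act k (g k) U Q γ‖ ≤ n k (g' k) U γ ∧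
        ‖act k (g k) U Q γ - act k (g' k) U Q γ‖ ≤ clip k * |g k - g' k| * n k (g' k) U γ)
    (hqT0 : ∀ k, 0 ≤ qT k)
    (hTcup : ∀ g ∈ W, ∀ g' ∈ W, ∀ (k : ℕ) (y : ι),
      |compProj 𝒯 P k g (E g) y - compProj 𝒯 P k g' (E g) y| ≤ wt k y * (qT k * |g k - g' k|))
    (hreprV : ∀ (k : ℕ) (s : ℝ) (Q : ι → ℝ) (U : Bg) (X : C.Dom),
      Ψ k s Q U X = (G.newTerm act k s U X (ρ k Q)).re - (G.newTerm act k s U₀ X (ρ k Q)).re + explZ k U X)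
    (hclipb : ∀ k, clip k ≤ clipbar) (hqTb : ∀ k, qT k ≤ qTbar)
    (hK : TwoPointKP G W act 𝒜 n lip a d) (hdec : G.DecayExtract δ d) (hpin : G.PinBudget a δ (fun _ => B) κ)
    (hρ : ∀ (k : ℕ) (Q Q' : ι → ℝ) (M : ℝ), (∀ y, |Q y - Q' y| ≤ wt k y * M) → ‖ρ k Q - ρ k Q'‖ ≤ M)
    (hexplZ : ∀ (k : ℕ) (U : Bg) (X : C.Dom), C.scale X = k + 1 → |explZ k U X| ≤ Real.exp (-(κ * C.d X)) * p₀ k)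
    (hbase : ∀ g ∈ W, ∀ (U : Bg) (X : C.Dom), C.scale X = 0 → |E g U X| ≤ Real.exp (-(κ * C.d X)) * N 0)
    (hNsucc : ∀ j, p₀ j + 2 * B ≤ N (j + 1)) (hNnn : ∀ j, 0 ≤ N j)
    (hbox : ∀ (k : ℕ) (Q : ι → ℝ), (∀ y, |Q y| ≤ wt k y * sizeRadius (fun k j => (1 + c) * τ k j) N k) → ρ k Q ∈ 𝒜 k)
    (hB : 0 ≤ B) (hlipb : ∀ k, lip k ≤ lipbar) (hτbar : 0 ≤ τbar) (hω : 0 ≤ ω)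
    (hpos : 0 < ω + 8 * lipbar * B * ((1 + c) * τbar))
    (hτ : ∀ k j, j ≤ k → 0 ≤ τ k j ∧ τ k j ≤ τbar * ω ^ (k - j)) :
    TermSize E W κ N ∧
      NE9 E W κ (prodModuli (8 * clipbar * B + 8 * lipbar * B * qTbar)
        fun _ => ω + 8 * lipbar * B * ((1 + c) * τbar)) ∧
        FadingMemory ((8 * clipbar * B + 8 * lipbar * B * qTbar) / (ω + 8 * lipbar * B * ((1 + c) * τbar)))
          (ω + 8 * lipbar * B * ((1 + c) * τbar))
          (prodModuli (8 * clipbar * B + 8 * lipbar * B * qTbar) fun _ => ω + 8 * lipbar * B * ((1 + c) * τbar)) := by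
  have hτ' : ∀ k j, j ≤ k → 0 ≤ (1 + c) * τ k j ∧ (1 + c) * τ k j ≤ (1 + c) * τbar * ω ^ (k - j) :=
    compWeights_profile hc hτ
  have hτbar' : 0 ≤ (1 + c) * τbar := mul_nonneg (by linarith) hτbar
  exact ne9_and_fadingMemory_of_couplingTwoPoint_vacSub_sizeInduction G ρ U₀ explZ h0 hAdm hres
    (channelAdditive_compProj hPadd hPinto hadd) (channelStepSum_compProj hPcomm hPinto hsum)
    (channelSizeAtStepNN_compProj hPcomm hPinto hPsize hc hstep) hfac hclip0 hCup hqT0 hTcup hreprV hclipb hqTb hK hdec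
    hpin hρ hexplZ hbase hNsucc hNnn hbox hB hlipb hτbar' hω hpos hτ'

/-- **THE SAME WITH THE READ-OUT PROJECTION** `P := margProj r A` (c = cr·a): three of the four projection binders are
DERIVED from the read-out's additivity/zero/size (node U2's (R), §3) and the marginal direction's size; `ProjInto` (the
projected families are marginal-free, i.e. `r` is normalised by `r(A) = 1` on each scale) stays displayed.
[cite: Balaban1987RG1, (0.28)-(0.29) p.258, (1.3) p.260, (1.20)-(1.22) p.264] -/
theorem ne9_and_fadingMemory_of_couplingTwoPoint_vacSub_sizeInduction_margProj (G : ClusterGeom C) {Pot : Type*}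
    [NormedAddCommGroup Pot] [NormedSpace ℂ Pot] {E : Functional C Bg} {W : Set (ℕ → ℝ)} {Adm MF : Set (Bg → C.Dom → ℝ)}
    {r : ℕ → (Bg → C.Dom → ℝ) → ℝ} {A : Bg → C.Dom → ℝ} {𝒯 : ℕ → (ℕ → ℝ) → (Bg → C.Dom → ℝ) → ι → ℝ}
    {Ψ : ℕ → ℝ → (ι → ℝ) → Bg → C.Dom → ℝ} {act : ℕ → ℝ → Bg → Pot → G.P → ℂ} {𝒜 : ℕ → Set Pot}
    {n : ℕ → ℝ → Bg → G.P → ℝ} {lip clip : ℕ → ℝ} {a d : G.P → ℝ} {δ : C.Dom → ℝ}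
    {κ B lipbar clipbar qTbar τbar ω cr aA : ℝ} {wt : ℕ → ι → ℝ} {τ : ℕ → ℕ → ℝ} {qT p₀ N : ℕ → ℝ}
    (ρ : ℕ → (ι → ℝ) → Pot) (U₀ : Bg) (explZ : ℕ → Bg → C.Dom → ℝ) (h0 : ScaleZeroFree E W)
    (hAdm : AdmissibleTerms E W Adm) (hres : AdmRestrict Adm)
    -- the read-out, the marginal direction, the marginal-free class
    (hrA : ReadAdditive Adm r) (hr0 : ReadZero r) (hrs : ReadSize Adm r κ cr) (hA : DirSize A κ aA) (hcr : 0 ≤ cr)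
    (haA : 0 ≤ aA) (hPinto : ProjInto Adm MF (margProj r A))
    (hadd : ChannelAdditive MF 𝒯) (hsum : ChannelStepSum MF 𝒯) (hstep : ChannelSizeAtStepNN MF 𝒯 κ wt τ)
    -- g21's remaining binders at `T := 𝒯 ∘ margProj r A`
    (hfac : Factorises E W (compProj 𝒯 (margProj r A)) Ψ) (hclip0 : ∀ k, 0 ≤ clip k)
    (hCup : ∀ g ∈ W, ∀ g' ∈ W, ∀ (k : ℕ) (U : Bg) (X : C.Dom), C.scale X = k + 1 → ∀ Q ∈ 𝒜 k, ∀ γ ∈ G.vol X,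
      ‖act k (g k) U Q γ‖ ≤ n k (g' k) U γ ∧
        ‖act k (g k) U Q γ - act k (g' k) U Q γ‖ ≤ clip k * |g k - g' k| * n k (g' k) U γ)
    (hqT0 : ∀ k, 0 ≤ qT k)
    (hTcup : ∀ g ∈ W, ∀ g' ∈ W, ∀ (k : ℕ) (y : ι),
      |compProj 𝒯 (margProj r A) k g (E g) y - compProj 𝒯 (margProj r A) k g' (E g) y| ≤
        wt k y * (qT k * |g k - g' k|))
    (hreprV : ∀ (k : ℕ) (s : ℝ) (Q : ι → ℝ) (U : Bg) (X : C.Dom),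
      Ψ k s Q U X = (G.newTerm act k s U X (ρ k Q)).re - (G.newTerm act k s U₀ X (ρ k Q)).re + explZ k U X)
    (hclipb : ∀ k, clip k ≤ clipbar) (hqTb : ∀ k, qT k ≤ qTbar)
    (hK : TwoPointKP G W act 𝒜 n lip a d) (hdec : G.DecayExtract δ d) (hpin : G.PinBudget a δ (fun _ => B) κ)
    (hρ : ∀ (k : ℕ) (Q Q' : ι → ℝ) (M : ℝ), (∀ y, |Q y - Q' y| ≤ wt k y * M) → ‖ρ k Q - ρ k Q'‖ ≤ M)
    (hexplZ : ∀ (k : ℕ) (U : Bg) (X : C.Dom), C.scale X = k + 1 → |explZ k U X| ≤ Real.exp (-(κ * C.d X)) * p₀ k)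
    (hbase : ∀ g ∈ W, ∀ (U : Bg) (X : C.Dom), C.scale X = 0 → |E g U X| ≤ Real.exp (-(κ * C.d X)) * N 0)
    (hNsucc : ∀ j, p₀ j + 2 * B ≤ N (j + 1)) (hNnn : ∀ j, 0 ≤ N j)
    (hbox : ∀ (k : ℕ) (Q : ι → ℝ),
      (∀ y, |Q y| ≤ wt k y * sizeRadius (fun k j => (1 + cr * aA) * τ k j) N k) → ρ k Q ∈ 𝒜 k)
    (hB : 0 ≤ B) (hlipb : ∀ k, lip k ≤ lipbar) (hτbar : 0 ≤ τbar) (hω : 0 ≤ ω)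
    (hpos : 0 < ω + 8 * lipbar * B * ((1 + cr * aA) * τbar))
    (hτ : ∀ k j, j ≤ k → 0 ≤ τ k j ∧ τ k j ≤ τbar * ω ^ (k - j)) :
    TermSize E W κ N ∧
      NE9 E W κ (prodModuli (8 * clipbar * B + 8 * lipbar * B * qTbar)
        fun _ => ω + 8 * lipbar * B * ((1 + cr * aA) * τbar)) ∧
        FadingMemory ((8 * clipbar * B + 8 * lipbar * B * qTbar) / (ω + 8 * lipbar * B * ((1 + cr * aA) * τbar)))
          (ω + 8 * lipbar * B * ((1 + cr * aA) * τbar))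
          (prodModuli (8 * clipbar * B + 8 * lipbar * B * qTbar) fun _ => ω + 8 * lipbar * B * ((1 + cr * aA) * τbar)) :=
  ne9_and_fadingMemory_of_couplingTwoPoint_vacSub_sizeInduction_compProj G ρ U₀ explZ h0 hAdm hres
    (projAdditive_margProj A hrA) (projScaleComm_margProj Adm A hr0) hPinto (projSize_margProj hrs hA hcr)
    (mul_nonneg hcr haA) hadd hsum hstep hfac hclip0 hCup hqT0 hTcup hreprV hclipb hqTb hK hdec hpin hρ hexplZ hbase hNsucc
    hNnn hbox hB hlipb hτbar hω hpos hτ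

/-! ## §2 Necessity toy: a marginal direction does not fade; the projection cures it -/

/-- Toy carriers: a domain is (creation step, marginal?) with tree length 0; one background. [folklore] -/
abbrev toyC : Carriers where
  Dom := ℕ × Bool
  scale := Prod.fst
  d := fun _ => 0
  d_nonneg := fun _ => le_rfl
  BgA := Unit
  BgB := Unit
  gauge := fun _ _ => 0
  gauge_nonneg := fun _ _ => le_rfl
  transport := id

/-- Toy channel (one output index): the MARGINAL component of every creation step enters with weight 1 whatever its age, the
irrelevant component with the factor `ω^{age}` — the kernel shadow of «`c·A_□` on the scale-j cubes feeds the step-k curly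
bracket the full quadratic form, while an irrelevant term feeds it `O((L^jη)^α)`» ([I] (0.27)–(0.30) p. 258).
[cite: Balaban1987RG1, (0.27)-(0.30) p.258] -/
def toyT (ω : ℝ) : ℕ → (ℕ → ℝ) → (Unit → toyC.Dom → ℝ) → Unit → ℝ :=
  fun k _ H _ => ∑ j ∈ Finset.range (k + 1), (H () (j, true) + ω ^ (k - j) * H () (j, false))

/-- The toy marginal-free class: no marginal component at any step. [folklore] -/
def toyMF : Set (Unit → toyC.Dom → ℝ) := {H | ∀ j, H () (j, true) = 0}

/-- The pure marginal family of the step j (the shadow of `A_□` on the scale-j cubes). [folklore] -/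
def toyMarg (j : ℕ) : Unit → toyC.Dom → ℝ := fun _ X => if X.1 = j then (if X.2 then 1 else 0) else 0

/-- The toy channel reads the step-j marginal family as 1 at every later step. [folklore] -/
theorem toyT_toyMarg (ω : ℝ) {k j : ℕ} (hjk : j ≤ k) (s : ℕ → ℝ) : toyT ω k s (toyMarg j) () = 1 := by
  simp only [toyT, toyMarg]
  rw [Finset.sum_eq_single j]
  · simp
  · intro i _ hi
    simp [hi]
  · intro hj
    exact absurd (Finset.mem_range.mpr (Nat.lt_succ_of_le hjk)) hj

/-- **NECESSITY**: on the FULL class the toy channel satisfies the per-step size binder for NO geometric weight profile with ratio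
`< 1` — the marginal direction of the step j is read with weight ≥ 1 at every later step. [folklore] -/
theorem not_fading_on_full_class (ω : ℝ) {τ : ℕ → ℕ → ℝ} {τbar ω' : ℝ} (hω' : ω' < 1)
    (hτ : ∀ k j, j ≤ k → τ k j ≤ τbar * ω' ^ (k - j)) :
    ¬ ChannelSizeAtStepNN (C := toyC) Set.univ (toyT ω) 0 (fun _ _ => 1) τ := by
  intro hstep
  -- the marginal family of step 0 forces `1 ≤ τ k 0` at every step k
  have hge : ∀ k, 1 ≤ τ k 0 := by
    intro k
    have h := hstep k 0 (Nat.zero_le k) (fun _ => 0) (toyMarg 0) (Set.mem_univ _)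
      (fun _ X hX => by simp [toyMarg, hX]) 1 zero_le_one
      (fun _ X _ => by
        rcases X with ⟨i, b⟩
        by_cases hi : i = 0 <;> cases b <;> simp [toyMarg, hi])
      ()
    rw [toyT_toyMarg ω (Nat.zero_le k)] at h
    simpa using h
  -- but `τ k 0 ≤ τbar·ω'^k`, which drops below 1
  by_cases hτbar : τbar ≤ 0
  · have h := (hge 0).trans (hτ 0 0 le_rfl)
    simp only [Nat.sub_zero, pow_zero, mul_one] at h
    linarith
  · have hτbar : 0 < τbar := lt_of_not_ge hτbar
    obtain ⟨m, hm⟩ := exists_pow_lt_of_lt_one (inv_pos.mpr hτbar) hω'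
    have h := (hge m).trans (hτ m 0 (Nat.zero_le m))
    rw [Nat.sub_zero] at h
    have : τbar * ω' ^ m < τbar * τbar⁻¹ := mul_lt_mul_of_pos_left hm hτbar
    rw [mul_inv_cancel₀ hτbar.ne'] at this
    linarith

/-- **ON THE MARGINAL-FREE CLASS THE TOY CHANNEL FADES** with the profile `ω^{k−j}` (`0 ≤ ω`). [folklore] -/
theorem fading_on_toyMF {ω : ℝ} (hω : 0 ≤ ω) :
    ChannelSizeAtStepNN (C := toyC) toyMF (toyT ω) 0 (fun _ _ => 1) (fun k j => ω ^ (k - j)) := by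
  intro k j hjk s H hH hsupp N _ hbound u
  have hsum : toyT ω k s H u = ω ^ (k - j) * H () (j, false) := by
    simp only [toyT]
    rw [Finset.sum_eq_single j]
    · rw [hH j, zero_add]
    · intro i _ hi
      rw [hH i, hsupp () (i, false) hi, mul_zero, add_zero]
    · intro hj
      exact absurd (Finset.mem_range.mpr (Nat.lt_succ_of_le hjk)) hj
  have hb : |H () (j, false)| ≤ N := by simpa using hbound () (j, false) rfl
  rw [hsum, abs_mul, abs_of_nonneg (pow_nonneg hω _), one_mul]
  exact mul_le_mul_of_nonneg_left hb (pow_nonneg hω _)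

/-- The toy read-out: the marginal component of the step-j slice. [folklore] -/
def toyRead : ℕ → (Unit → toyC.Dom → ℝ) → ℝ := fun j H => H () (j, true)

/-- The toy marginal direction: 1 on the marginal domains, 0 on the irrelevant ones (normalised: `toyRead j` of it is 1).
[folklore] -/
def toyDir : Unit → toyC.Dom → ℝ := fun _ X => if X.2 then 1 else 0

/-- The toy read-out projection lands in the marginal-free class. [folklore] -/
theorem toy_projInto : ProjInto (C := toyC) Set.univ toyMF (margProj toyRead toyDir) := by
  intro H _ j
  simp [margProj, toyRead, toyDir, restrictScale]

/-- **THE CURE**: the composed toy channel `toyT ∘ margProj` satisfies the per-step size binder on the FULL class with the FADING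
profile `2·ω^{k−j}` (factor `1 + cr·a` with `cr = a = 1`). [folklore] -/
theorem toy_compProj_fading {ω : ℝ} (hω : 0 ≤ ω) :
    ChannelSizeAtStepNN (C := toyC) Set.univ (compProj (toyT ω) (margProj toyRead toyDir)) 0 (fun _ _ => 1)
      (fun k j => (1 + 1 * 1) * ω ^ (k - j)) := by
  refine channelSizeAtStepNN_compProj (MF := toyMF) (projScaleComm_margProj _ _ fun j => rfl) toy_projInto
    (projSize_margProj (fun j H _ N _ hbound => ?_) (fun u X => ?_) zero_le_one) (by norm_num) (fading_on_toyMF hω)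
  · simpa [toyRead, restrictScale] using hbound () (j, true) rfl
  · rcases X with ⟨i, b⟩
    cases b <;> simp [toyDir]

end Summit.QuantumFields.BalabanUV.T4Continuum.NE9MarginalProjectionEnd

end
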